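import Literature.Topology.PlanarFoliations.ZoneOfTerminal
import Literature.Topology.PlanarFoliations.HugTurn
import Literature.Topology.PlanarFoliations.HugState
import Literature.Topology.PlanarFoliations.LeafBase
import HarnessLib

/-!
# The facial petal walk of a terminal polygon (generic case)

Topic: Topology / PlanarFoliations, sequel to `ZoneOfTerminal.lean` (a terminal essential polygon
is a terminal zone), `ZoneLeaves.lean` (inner leaves of a terminal zone are separatrices at both
ends), `HugTurn.lean` (across a prong: the neighbouring prong carries a backward tail).

Under the **genericity hypothesis** `hgen` — every separatrix has the same puncture at both
ends (which holds when distinct punctures lie in distinct leaves of `T`) — a simple separatrix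
polygon is a petal (`m = 1`), and at the saddle `v` of a terminal essential petal `Z` with
separatrix `S₀` we construct the **facial petal walk**: starting from the arrival prong of `S₀`,
turn to the inner side `s`; the neighbouring prong carries the departure of a leaf which is `S₀`
(then the walk closes) or an inner petal at `v` (by `hgen`), whose arrival prong is the next one.
This file proves the orbit structure (Stage A): tails of a leaf at a star are on one prong
whatever the base point; the turn is an involution; the inner side at the arrival prong; the
prong orbit is periodic.

## References

* C. Camacho, A. Lins Neto, *Geometric Theory of Foliations*, Birkhäuser (1985), Ch. VII §2
  [CamachoLinsNeto1985].
-/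

noncomputable section

open Set Filter Function Metric
open _root_.Topology
open Literature.Topology.FourManifolds Literature.Topology.FourManifolds.Foliation Literature.Topology.PlaneTopology

namespace Literature.Topology.PlanarFoliations

variable {X : Type*} [TopologicalSpace X] [T2Space X] [SecondCountableTopology X] [Nonempty X] {F : Foliation ℝ X} {ι : X → ℂ}

/-! ## Tails of a leaf are on one prong, whatever the base point -/

namespace ProngStar

variable {v : ℂ} {n : ℕ} (P : ProngStar F ι v n) {hbi : IsBiOriented F}

omit [Nonempty X] in
/-- **Two forward tails of one leaf at a star are on the same prong**, for any base points.
[folklore] -/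
theorem FwdTail.j_eq_of_mem_leaf {x x' : X} [NoncompactSpace (F.Leaf x)] [NoncompactSpace (F.Leaf x')] (hx' : x' ∈ F.leaf x)
    (E : P.FwdTail hbi x) (E' : P.FwdTail hbi x') : E.j = E'.j := by
  -- a base point in the forward half-leaf of the other tail settles it
  have key : ∀ {y y' : X} [NoncompactSpace (F.Leaf y)] [NoncompactSpace (F.Leaf y')] (hy' : y' ∈ F.leaf y)
      (G : P.FwdTail hbi y) (G' : P.FwdTail hbi y'), Leaf.rebase hy' G'.p ∈ fwd hbi G.p → G.j = G'.j := by
    intro y y' _ _ hy' G G' hmem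
    obtain ⟨β, hβ, hβp⟩ := (G.fwd_iff _).1 hmem
    rw [Leaf.pt_rebase] at hβp
    have h1 : P.pt G'.j (G'.β₀, 0) ∈ P.S G.j := by
      rw [← G'.hp, hβp]
      exact P.pt_mem ((P.mem_rect_iff).2 ⟨⟨hβ.1.le, hβ.2.trans G.hβ₀.2⟩, by simp [P.ρ_pos.le]⟩)
    exact P.eq_of_pt_mem_S G'.hβ₀ h1
  have hx : x ∈ F.leaf x' := mem_leaf_comm.1 hx'
  rcases leafLT_trichotomy (hbi := hbi) E.p (Leaf.rebase hx' E'.p) with h | h | h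
  · exact key hx' E E' (mem_fwd_of_leafLT h)
  · exact key hx' E E' (h ▸ mem_fwd_self _)
  · refine (key hx E' E ?_).symm
    have h' : leafLT hbi (Leaf.rebase hx' E'.p) (Leaf.rebase hx' (Leaf.rebase hx E.p)) := h
    exact mem_fwd_of_leafLT ((leafLT_rebase_iff hx').1 h')

omit [Nonempty X] in
/-- **Two backward tails of one leaf at a star are on the same prong**, for any base points.
[folklore] -/
theorem BwdTail.j_eq_of_mem_leaf {x x' : X} [NoncompactSpace (F.Leaf x)] [NoncompactSpace (F.Leaf x')] (hx' : x' ∈ F.leaf x)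
    (E : P.BwdTail hbi x) (E' : P.BwdTail hbi x') : E.j = E'.j := by
  have key : ∀ {y y' : X} [NoncompactSpace (F.Leaf y)] [NoncompactSpace (F.Leaf y')] (hy' : y' ∈ F.leaf y)
      (G : P.BwdTail hbi y) (G' : P.BwdTail hbi y'), Leaf.rebase hy' G'.p ∈ bwd hbi G.p → G.j = G'.j := by
    intro y y' _ _ hy' G G' hmem
    obtain ⟨β, hβ, hβp⟩ := (G.bwd_iff _).1 hmem
    rw [Leaf.pt_rebase] at hβp
    have h1 : P.pt G'.j (G'.β₀, 0) ∈ P.S G.j := by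
      rw [← G'.hp, hβp]
      exact P.pt_mem ((P.mem_rect_iff).2 ⟨⟨hβ.1.le, hβ.2.trans G.hβ₀.2⟩, by simp [P.ρ_pos.le]⟩)
    exact P.eq_of_pt_mem_S G'.hβ₀ h1
  have hx : x ∈ F.leaf x' := mem_leaf_comm.1 hx'
  rcases leafLT_trichotomy (hbi := hbi) E.p (Leaf.rebase hx' E'.p) with h | h | h
  · refine (key hx E' E ?_).symm
    have h' : leafLT hbi (Leaf.rebase hx' (Leaf.rebase hx E.p)) (Leaf.rebase hx' E'.p) := h
    exact leafLT_asymm ((leafLT_rebase_iff hx').1 h')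
  · exact key hx' E E' (h ▸ mem_bwd_self _)
  · exact key hx' E E' (leafLT_asymm h)

/-! ## The turn is an involution -/

omit [T2Space X] [SecondCountableTopology X] [Nonempty X] in
/-- **Turning twice on the same side comes back**: `nb (nb j s) s = j` for `s = ±1`. [folklore] -/
theorem nb_nb {s : ℝ} (hs : s = 1 ∨ s = -1) (j : ZMod n) : P.nb (P.nb j s) s = j := by
  have hsucc := P.sg_succ j
  have hpred : P.sg (j - 1) = -P.sg j := by
    have := P.sg_succ (j - 1); rw [sub_add_cancel] at this; linarith
  have key : ∀ {t : ℝ}, (t = 1 ∨ t = -1) → ∀ {a : ℝ}, (a = 1 ∨ a = -1) →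
      (if 0 ≤ (if 0 ≤ a * t then -a else -a) * t then (if 0 ≤ a * t then j + 1 else j - 1) + 1
        else (if 0 ≤ a * t then j + 1 else j - 1) - 1) = j := by
    intro t ht a ha
    rcases ht with rfl | rfl <;> rcases ha with rfl | rfl <;> norm_num
  unfold nb
  have h1 : P.sg (if 0 ≤ P.sg j * s then j + 1 else j - 1) = (if 0 ≤ P.sg j * s then -P.sg j else -P.sg j) := by
    split_ifs <;> [exact hsucc; exact hpred]
  rw [h1]
  exact key hs (P.sg_sq j)

omit [T2Space X] [SecondCountableTopology X] [Nonempty X] in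
/-- The turn on a side is injective. [folklore] -/
theorem nb_injective {s : ℝ} (hs : s = 1 ∨ s = -1) : Injective fun j ↦ P.nb j s := fun j j' h ↦ by
  have := congrArg (fun k ↦ P.nb k s) h
  simpa only [P.nb_nb hs] using this

/-! ## The horizontal path in the height variable -/

omit [T2Space X] [SecondCountableTopology X] in
/-- **The points of the sector over a fixed `β > 0` depend continuously on the height.**
[folklore] -/
theorem continuousOn_horiz_vert (hι : IsOpenEmbedding ι) (j : ZMod n) {β : ℝ} (hβ : β ∈ Ioc 0 P.ρ) :
    ContinuousOn (fun h ↦ P.horiz hι j h β) (Icc (-P.ρ) P.ρ) := by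
  have hT : ∀ h ∈ Icc (-P.ρ) P.ρ, ((β, h) : ℝ × ℝ) ∈ P.rect ∧ ((β, h) : ℝ × ℝ) ≠ 0 := fun h hh ↦
    ⟨⟨⟨hβ.1.le, hβ.2⟩, hh⟩, fun h0 ↦ hβ.1.ne' (congrArg Prod.fst h0)⟩
  have hc : ContinuousOn (fun h : ℝ ↦ P.pt j (β, h)) (Icc (-P.ρ) P.ρ) :=
    (P.continuousOn_pt j).comp (continuous_const.prodMk continuous_id).continuousOn fun h hh ↦ (hT h hh).1
  exact (continuousOn_lift hι).comp hc fun h hh ↦ P.diff_subset_range j ⟨P.pt_mem (hT h hh).1, P.pt_ne (hT h hh).1 (hT h hh).2⟩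

end ProngStar

variable {B : Type*} [NormedAddCommGroup B] {M : Type*} [TopologicalSpace M] {T : Foliation B M} {g : ℂ → M}

namespace StarData

variable (D : StarData F ι T g) (hbi : IsBiOriented F) (hι : IsOpenEmbedding ι) (ho : F.IsTransverselyOriented)
  {x₀ : X} (hK₀ : IsCompact (F.leaf x₀)) (hC₀ : IsCompact (discLeaf F ι x₀)) (hΩ : discLeaf F ι x₀ ⊆ D.Ω)
  (hgen : ∀ (y : X) [NoncompactSpace (F.Leaf y)], (∀ q : F.Leaf y, ι (Leaf.pt q) ∈ discLeaf F ι x₀) →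
    ∀ v ∈ D.P, ∀ w ∈ D.P, omegaSet hbi ι y = {v} → alphaSet hbi ι y = {w} → v = w)

namespace PolyCycle

variable {D} {C : Set ℂ} (Z : D.PolyCycle hbi C)

omit [Nonempty X] in
/-- **Generically, a simple separatrix polygon is a petal**: if every open leaf in `C` has the
same puncture at both ends, the polygon has one separatrix. [folklore] -/
theorem m_eq_one (hgenC : ∀ (y : X) [NoncompactSpace (F.Leaf y)], (∀ q : F.Leaf y, ι (Leaf.pt q) ∈ C) →
    ∀ v ∈ D.P, ∀ w ∈ D.P, omegaSet hbi ι y = {v} → alphaSet hbi ι y = {w} → v = w) : Z.m = 1 := by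
  haveI := Z.neZero
  -- the separatrix `sx 1` runs from `vtx 0` to `vtx 1`
  have hω : omegaSet hbi ι (Z.sx (0 + 1)) = {Z.vtx (0 + 1)} := Z.omega (0 + 1)
  have hα : alphaSet hbi ι (Z.sx (0 + 1)) = {Z.vtx 0} := Z.alpha 0
  have hvv : Z.vtx (0 + 1) = Z.vtx 0 := hgenC _ (Z.hmem (0 + 1)) _ (Z.hv _) _ (Z.hv _) hω hα
  have h10 : (0 : Fin Z.m) + 1 = 0 := Z.hvtx hvv
  rw [zero_add] at h10
  have h := congrArg Fin.val h10
  rw [Fin.val_one', Fin.val_zero] at h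
  exact Nat.dvd_one.1 (Nat.dvd_of_mod_eq_zero h)

end PolyCycle

/-! ## The facial petal walk: Stage A, the prong orbit -/

namespace PolyPattern

variable {D} {hbi} {hι} {hC₀} (P : D.PolyPattern hbi hι x₀ hC₀)
  (hterm : ∀ Q : D.PolyPattern hbi hι x₀ hC₀, Q.Z.fill hι hC₀ ⊆ P.Z.fill hι hC₀ → Q.Z.fill hι hC₀ = P.Z.fill hι hC₀)
  (hcterm : ∀ Q : D.CompactPattern x₀, discLeaf F ι Q.y ⊆ P.Z.fill hι hC₀ → discLeaf F ι Q.y = P.Z.fill hι hC₀)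

/-- The saddle of the petal. [folklore] -/
def v0 : ℂ := P.Z.vtx 0

/-- The saddle has prongs. [folklore] -/
theorem hv0 : D.nprong P.v0 ≠ 0 := D.nprong_vtx_ne_zero hC₀ P.Z.hv P.Z.hmem P.Z.omega 0 (hbi := hbi)

/-- The star of the saddle. [folklore] -/
def Pv : ProngStar F ι P.v0 (D.nprong P.v0) := D.star P.v0 P.hv0

/-- The number of prongs of the saddle is not zero. [folklore] -/
instance instNeZeroNprong : NeZero (D.nprong P.v0) := ⟨P.hv0⟩

/-- **The prong base point** of the prong `q`: the outer end of the prong arc. [folklore] -/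
def pb (q : ZMod (D.nprong P.v0)) : X := P.Pv.horiz hι q 0 P.Pv.ρ

/-- The radius is an admissible prong parameter. [folklore] -/
theorem ρ_mem : P.Pv.ρ ∈ Ioc 0 P.Pv.ρ := ⟨P.Pv.ρ_pos, le_rfl⟩

/-- The leaf of a prong base point is not compact. [folklore] -/
theorem not_isCompact_leaf_pb (q : ZMod (D.nprong P.v0)) : ¬ IsCompact (F.leaf (P.pb q)) :=
  D.not_isCompact_leaf_horiz_zero hι P.hv0 q P.ρ_mem

/-- The leaf of a prong base point is an open leaf. [folklore] -/
instance instNoncompactPb (q : ZMod (D.nprong P.v0)) : NoncompactSpace (F.Leaf (P.pb q)) :=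
  noncompactSpace_leaf_of_not_isCompact' (P.not_isCompact_leaf_pb q)

/-- The prong parameters are in the half square. [folklore] -/
theorem prong_mem_rect {b : ℝ} (hb : b ∈ Ioc 0 P.Pv.ρ) : ((b, (0 : ℝ)) : ℝ × ℝ) ∈ P.Pv.rect :=
  (P.Pv.mem_rect_iff).2 ⟨⟨hb.1.le, hb.2⟩, ⟨by linarith [P.Pv.ρ_pos], P.Pv.ρ_pos.le⟩⟩

/-- The prong points are on the leaf of the prong base point. [folklore] -/
theorem horiz_mem_leaf_pb (q : ZMod (D.nprong P.v0)) {b : ℝ} (hb : b ∈ Ioc 0 P.Pv.ρ) : P.Pv.horiz hι q 0 b ∈ F.leaf (P.pb q) :=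
  P.Pv.horiz_mem_leaf' hι (P.prong_mem_rect P.ρ_mem) (P.prong_mem_rect hb) (Or.inr ⟨P.ρ_mem.1, hb.1⟩)

/-- **The arrival prong of the leaf of the prong `p`**, when that leaf lies in the disc and
arrives at the saddle; else `p` itself (junk). [folklore] -/
def arr (p : ZMod (D.nprong P.v0)) : ZMod (D.nprong P.v0) := by
  classical
  exact if h : (∀ q : F.Leaf (P.pb p), ι (Leaf.pt q) ∈ discLeaf F ι x₀) ∧ omegaSet hbi ι (P.pb p) = {P.v0} then
    (Classical.choice (P.Pv.nonempty_fwdTail hι (hbi := hbi) hC₀ h.1 h.2)).j else p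

/-- **The arrival prong is that of any forward tail of the leaf.** [folklore] -/
theorem arr_eq {p : ZMod (D.nprong P.v0)} (hmem : ∀ q : F.Leaf (P.pb p), ι (Leaf.pt q) ∈ discLeaf F ι x₀)
    (hω : omegaSet hbi ι (P.pb p) = {P.v0}) {y : X} [NoncompactSpace (F.Leaf y)] (hy : y ∈ F.leaf (P.pb p)) (E : P.Pv.FwdTail hbi y) :
    P.arr p = E.j := by
  classical
  unfold arr
  rw [dif_pos ⟨hmem, hω⟩]
  exact ProngStar.FwdTail.j_eq_of_mem_leaf P.Pv hy _ E

/-- **The successor prong** on the side `s`: the arrival prong of the leaf departing on the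
neighbour `nb q s`. [folklore] -/
def nextProng (s : ℝ) (q : ZMod (D.nprong P.v0)) : ZMod (D.nprong P.v0) := P.arr (P.Pv.nb q s)

/-- **The prong orbit** of the arrival prong `q₀` on the side `s`. [folklore] -/
def orbit (s : ℝ) (q₀ : ZMod (D.nprong P.v0)) (k : ℕ) : ZMod (D.nprong P.v0) := (P.nextProng s)^[k] q₀

/-- The orbit starts at `q₀`. [folklore] -/
@[simp] theorem orbit_zero (s : ℝ) (q₀ : ZMod (D.nprong P.v0)) : P.orbit s q₀ 0 = q₀ := rfl

/-- The orbit steps by the successor. [folklore] -/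
theorem orbit_succ (s : ℝ) (q₀ : ZMod (D.nprong P.v0)) (k : ℕ) : P.orbit s q₀ (k + 1) = P.nextProng s (P.orbit s q₀ k) := by
  unfold orbit; rw [iterate_succ_apply']


/-! ## The zone of the terminal petal -/

/-- The arrival junction data of the separatrix `S₀` of the petal. [folklore] -/
def jcZ := D.jc hι hC₀ P.Z.hv P.Z.hmem P.Z.omega P.Z.alpha 0

/-- **The arrival prong of `S₀`.** [folklore] -/
def jin0 : ZMod (D.nprong P.v0) := P.jcZ.Ef.j

/-- The inside of the petal. [folklore] -/
def U : Set ℂ := IsJordanLoop.inside (P.Z.loop hι hC₀)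

/-- With `m = 1`, every index is `0`. [folklore] -/
theorem fin_eq_zero (hm : P.Z.m = 1) (i : Fin P.Z.m) : i = 0 := Fin.ext (by have := i.2; simp only [Fin.val_zero]; omega)

/-- **A point of the domain on the trace of the petal is a point of `S₀`.** [folklore] -/
theorem mem_leaf_of_mem_range (hm : P.Z.m = 1) {x : X} (hx : ι x ∈ range (P.Z.loop hι hC₀)) : x ∈ F.leaf (P.Z.sx 0) := by
  obtain ⟨i, hi⟩ := P.Z.exists_mem_leaf_of_mem_range hι hC₀ hx
  rwa [P.fin_eq_zero hm i] at hi

/-- The points of `S₀` are on the trace. [folklore] -/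
theorem mem_range_of_mem_leaf {x : X} (hx : x ∈ F.leaf (P.Z.sx 0)) : ι x ∈ range (P.Z.loop hι hC₀) :=
  P.Z.image_leaf_subset_range hι hC₀ 0 ⟨x, hx, rfl⟩

/-- The prong points of the arrival prong are on `S₀`. [folklore] -/
theorem horiz_jin0_mem {b : ℝ} (hb : b ∈ Ioc 0 P.Pv.ρ) : P.Pv.horiz hι P.jin0 0 b ∈ F.leaf (P.Z.sx 0) :=
  P.Pv.horiz_mem_leaf_of_fwdTail hbi hι P.jcZ.Ef hb

/-- The saddle is the ω-limit of `S₀`. [folklore] -/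
theorem omega0 : omegaSet hbi ι (P.Z.sx 0) = {P.v0} := P.Z.omega 0

/-- The saddle is the α-limit of `S₀` (for a petal). [folklore] -/
theorem alpha0 (hm : P.Z.m = 1) : alphaSet hbi ι (P.Z.sx 0) = {P.v0} := by
  have h := P.Z.alpha 0
  rw [P.fin_eq_zero hm (0 + 1)] at h
  exact h

/-- The saddle is a puncture. [folklore] -/
theorem v0_mem : P.v0 ∈ D.P := P.Z.hv 0

/-- The trace misses the inside. [folklore] -/
theorem not_mem_U_of_mem_range {z : ℂ} (hz : z ∈ range (P.Z.loop hι hC₀)) : z ∉ P.U := fun h ↦ h.1 hz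

/-- **An inner leaf**: a leaf with a point inside lies inside. [folklore] -/
theorem image_leaf_subset_U {y : X} (hy : ι y ∈ P.U) : ι '' F.leaf y ⊆ P.U :=
  image_leaf_subset_inside (P.Z.isJordanLoop_loop hι hC₀) (fun _ hx' _ hx'' ↦ P.Z.range_loop_saturated hι hC₀ hx' hx'') hι.continuous hy

include hK₀ in
/-- Inner leaves are in the ambient disc. [folklore] -/
theorem mem_disc_of_U {y : X} (hy : ι '' F.leaf y ⊆ P.U) (q : F.Leaf y) : ι (Leaf.pt q) ∈ discLeaf F ι x₀ :=
  P.fill_subset hK₀ (Or.inr (hy ⟨Leaf.pt q, q.2, rfl⟩))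

/-- The closure of the inside is the fill. [folklore] -/
theorem closure_U : closure P.U = P.U ∪ range (P.Z.loop hι hC₀) := (P.Z.isJordanLoop_loop hι hC₀).closure_inside_eq

include ho hK₀ hΩ hterm hcterm in
/-- **Every open leaf inside the terminal petal is a separatrix at both ends** (the zone theorem,
instantiated). [cite: CamachoLinsNeto1985, Ch. VII §2] -/
theorem limitSets_of_inner [NormedSpace ℝ B] [LocallyConnectedSpace B] {y : X} [NoncompactSpace (F.Leaf y)] (hyU : ι '' F.leaf y ⊆ P.U) :
    (∃ v ∈ D.P, omegaSet hbi ι y = {v} ∧ ∃ s ∈ D.levelLeaves v, y ∈ F.leaf s) ∧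
      (∃ v ∈ D.P, alphaSet hbi ι y = {v} ∧ ∃ s ∈ D.levelLeaves v, y ∈ F.leaf s) :=
  D.limitSets_of_inner_leaf hbi hι ho hC₀ hΩ (P.Z.isJordanLoop_loop hι hC₀) (P.fill_subset hK₀)
    (fun _ hx' _ hx'' ↦ P.Z.range_loop_saturated hι hC₀ hx' hx'')
    (P.imageNull_of_compact_inside hbi hι hK₀ hC₀ hcterm) (P.mem_range_of_essential hbi hι hC₀ hterm)
    (fun xk _ ↦ by
      obtain ⟨e, he, hxe⟩ := F.exists_mem_source xk
      exact ⟨e, he, hxe, P.Z.trace_eq_plaque_near hι hC₀ xk he hxe⟩) hyU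

/-! ## The inner side at the arrival prong -/

/-- **The side `s` is inner at the prong `q`**: the points of the sector `q` at small heights of
sign `s` are inside, uniformly over the prong parameter. [folklore] -/
structure InnerSide (s : ℝ) (q : ZMod (D.nprong P.v0)) : Prop where
  ev : ∃ δ > 0, ∀ β ∈ Ioc 0 P.Pv.ρ, ∀ h, 0 < s * h → |h| < δ → ι (P.Pv.horiz hι q h β) ∈ P.U

/-- Inner-sidedness over the outer parameter `ρ` spreads to all parameters. [folklore] -/
theorem innerSide_of_ρ {s : ℝ} {q : ZMod (D.nprong P.v0)} {δ : ℝ} (hδ : 0 < δ) (hδρ : δ ≤ P.Pv.ρ)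
    (h : ∀ h, 0 < s * h → |h| < δ → ι (P.Pv.horiz hι q h P.Pv.ρ) ∈ P.U) : P.InnerSide s q := by
  refine ⟨δ, hδ, fun β hβ h' hsh hh' ↦ ?_⟩
  have hh0 : h' ≠ 0 := by rintro rfl; simp at hsh
  have hhI : h' ∈ Icc (-P.Pv.ρ) P.Pv.ρ := by
    have := abs_lt.1 (hh'.trans_le hδρ); exact ⟨this.1.le, this.2.le⟩
  have hmem : P.Pv.horiz hι q h' β ∈ F.leaf (P.Pv.horiz hι q h' P.Pv.ρ) :=
    P.Pv.horiz_mem_leaf' hι ⟨⟨P.ρ_mem.1.le, le_rfl⟩, hhI⟩ ⟨⟨hβ.1.le, hβ.2⟩, hhI⟩ (Or.inl hh0)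
  exact P.image_leaf_subset_U (h h' hsh hh') ⟨_, hmem, rfl⟩

/-- **The inner side at the arrival prong of `S₀` exists.** [folklore] -/
theorem exists_innerSide_jin0 : ∃ s : ℝ, (s = 1 ∨ s = -1) ∧ P.InnerSide s P.jin0 := by
  have hJ := P.Z.isJordanLoop_loop hι hC₀
  set Pv := P.Pv with hPv
  set xk := P.pb P.jin0 with hxk
  have hxkS : xk ∈ F.leaf (P.Z.sx 0) := P.horiz_jin0_mem P.ρ_mem
  have hk : ι xk ∈ range (P.Z.loop hι hC₀) := P.mem_range_of_mem_leaf hxkS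
  have hr : ∀ {h : ℝ}, h ∈ Icc (-Pv.ρ) Pv.ρ → ((Pv.ρ, h) : ℝ × ℝ) ∈ Pv.rect := fun {h} hh ↦ ⟨⟨Pv.ρ_pos.le, le_rfl⟩, hh⟩
  have hne : ∀ (h : ℝ), ((Pv.ρ, h) : ℝ × ℝ) ≠ 0 := fun h h0 ↦ Pv.ρ_pos.ne' (congrArg Prod.fst h0)
  have hιh : ∀ {h : ℝ}, h ∈ Icc (-Pv.ρ) Pv.ρ → ι (Pv.horiz hι P.jin0 h Pv.ρ) = Pv.pt P.jin0 (Pv.ρ, h) := fun {h} hh ↦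
    Pv.ι_horiz hι (hr hh) (hne h)
  have h0I : (0 : ℝ) ∈ Icc (-Pv.ρ) Pv.ρ := ⟨by linarith [Pv.ρ_pos], Pv.ρ_pos.le⟩
  have hιxk : ι xk ∈ Pv.S P.jin0 := by rw [hxk, pb, hιh h0I]; exact Pv.pt_mem (hr h0I)
  -- the foliated structure at `xk`, and one-sidedness in that flow box
  obtain ⟨e, he, hxke, Un, hUn, hmono⟩ := Pv.foliated P.jin0 xk hιxk
  obtain ⟨s, hs, ε, hε, hin, -⟩ := exists_oneSided' hJ (fun _ hx' _ hx'' ↦ P.Z.range_loop_saturated hι hC₀ hx' hx'') hk he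
    (P.Z.trace_eq_plaque_near hι hC₀ xk he hxke) hι hxke
  refine ⟨s, hs, ?_⟩
  -- continuity of the vertical through `xk` in the sector
  have hcont : ContinuousAt (fun h ↦ Pv.horiz hι P.jin0 h Pv.ρ) 0 :=
    (Pv.continuousOn_horiz_vert hι P.jin0 P.ρ_mem).continuousAt (Icc_mem_nhds (by linarith [Pv.ρ_pos]) Pv.ρ_pos)
  have h0 : Pv.horiz hι P.jin0 0 Pv.ρ = xk := rfl
  have hce : ContinuousAt (fun h ↦ e (Pv.horiz hι P.jin0 h Pv.ρ)) 0 :=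
    (e.continuousAt (by rw [h0]; exact hxke)).comp hcont
  have hev : ∀ᶠ h in 𝓝 (0 : ℝ), Pv.horiz hι P.jin0 h Pv.ρ ∈ Un ∧ Pv.horiz hι P.jin0 h Pv.ρ ∈ e.source ∧
      |(e (Pv.horiz hι P.jin0 h Pv.ρ)).1 - (e xk).1| < ε ∧ |(e (Pv.horiz hι P.jin0 h Pv.ρ)).2 - (e xk).2| < ε ∧ h ∈ Ioo (-Pv.ρ) Pv.ρ := by
    have h1 : ∀ᶠ h in 𝓝 (0 : ℝ), Pv.horiz hι P.jin0 h Pv.ρ ∈ Un := hcont.eventually_mem (by simpa only [h0] using hUn)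
    have h2 : ∀ᶠ h in 𝓝 (0 : ℝ), Pv.horiz hι P.jin0 h Pv.ρ ∈ e.source :=
      hcont.eventually_mem (by simpa only [h0] using e.open_source.mem_nhds hxke)
    have h3 : ∀ᶠ h in 𝓝 (0 : ℝ), dist (e (Pv.horiz hι P.jin0 h Pv.ρ)) (e xk) < ε := by
      have := Metric.tendsto_nhds.1 hce ε hε; simpa only [h0] using this
    have h4 : ∀ᶠ h in 𝓝 (0 : ℝ), h ∈ Ioo (-Pv.ρ) Pv.ρ := Ioo_mem_nhds (by linarith [Pv.ρ_pos]) Pv.ρ_pos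
    filter_upwards [h1, h2, h3, h4] with h h1 h2 h3 h4
    rw [Prod.dist_eq, max_lt_iff, Real.dist_eq, Real.dist_eq] at h3
    exact ⟨h1, h2, h3.1, h3.2, h4⟩
  obtain ⟨δ, hδ, hball⟩ := Metric.eventually_nhds_iff.1 hev
  refine P.innerSide_of_ρ (lt_min hδ Pv.ρ_pos) (min_le_right _ _) fun h hsh hhδ ↦ ?_
  have hhδ' : |h| < δ := hhδ.trans_le (min_le_left _ _)
  obtain ⟨hUn', hsrc, hdu, hdt, hhI⟩ := hball (by rwa [dist_zero_right, Real.norm_eq_abs])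
  have hhI' : h ∈ Icc (-Pv.ρ) Pv.ρ := ⟨hhI.1.le, hhI.2.le⟩
  -- the height comparison: the sign of the height difference in `e` is that of `h`
  have hy : ι (Pv.horiz hι P.jin0 h Pv.ρ) ∈ Pv.S P.jin0 := by rw [hιh hhI']; exact Pv.pt_mem (hr hhI')
  have hHy : Pv.H (ι (Pv.horiz hι P.jin0 h Pv.ρ)) = h := by rw [hιh hhI', Pv.H_pt (hr hhI')]
  have hHxk : Pv.H (ι xk) = 0 := by rw [hxk, pb, hιh h0I, Pv.H_pt (hr h0I)]
  have hxkUn : xk ∈ Un := mem_of_mem_nhds hUn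
  have h1 := hmono xk hxkUn hιxk _ hUn' hy   -- (e xk).2 < (e y).2 ↔ H xk < H y
  have h2 := hmono _ hUn' hy xk hxkUn hιxk   -- (e y).2 < (e xk).2 ↔ H y < H xk
  rw [hHy, hHxk] at h1 h2
  have hsign : 0 < s * ((e (Pv.horiz hι P.jin0 h Pv.ρ)).2 - (e xk).2) := by
    rcases hs with rfl | rfl
    · have : 0 < h := by linarith
      linarith [h1.2 this]
    · have : h < 0 := by linarith
      linarith [h2.2 this]
  have := hin (e (Pv.horiz hι P.jin0 h Pv.ρ)).1 (e (Pv.horiz hι P.jin0 h Pv.ρ)).2 hdu hdt hsign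
  rwa [Prod.mk.eta, e.left_inv hsrc] at this

/-! ## The orbit invariant -/

/-- **An arrival prong**: the leaf of the prong lies in the ambient disc, arrives at the saddle,
and arrives on this very prong. [folklore] -/
structure IsArrival (q : ZMod (D.nprong P.v0)) : Prop where
  mem : ∀ r : F.Leaf (P.pb q), ι (Leaf.pt r) ∈ discLeaf F ι x₀
  omega : omegaSet hbi ι (P.pb q) = {P.v0}
  tail : ∃ E : P.Pv.FwdTail hbi (P.pb q), E.j = q

/-- **The arrival prong of `S₀` is an arrival prong.** [folklore] -/
theorem isArrival_jin0 : P.IsArrival P.jin0 := by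
  have hS : P.pb P.jin0 ∈ F.leaf (P.Z.sx 0) := P.horiz_jin0_mem P.ρ_mem
  have hleaf : F.leaf (P.pb P.jin0) = F.leaf (P.Z.sx 0) := leaf_eq_of_mem hS
  have hmem : ∀ r : F.Leaf (P.pb P.jin0), ι (Leaf.pt r) ∈ discLeaf F ι x₀ := fun r ↦
    P.Z.hmem 0 (Leaf.mk (Leaf.pt r) (by rw [← hleaf]; exact r.2))
  have hω : omegaSet hbi ι (P.pb P.jin0) = {P.v0} := by rw [omegaSet_eq_of_mem_leaf (hbi := hbi) hS]; exact P.omega0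
  refine ⟨hmem, hω, ?_⟩
  obtain ⟨E⟩ := P.Pv.nonempty_fwdTail hι (hbi := hbi) hC₀ hmem hω
  exact ⟨E, ProngStar.FwdTail.j_eq_of_mem_leaf P.Pv (mem_leaf_comm.1 hS) E P.jcZ.Ef⟩

/-- **The step of the facial walk.** From an arrival prong `q` with inner side `s`, the
neighbour `p = nb q s` carries the departure of a leaf which lies in the ambient disc, has the
saddle as α- and ω-limit, arrives on `arr p` — an arrival prong with inner side `s` — and is
`S₀` (with `arr p = jin0`) or an inner leaf. [cite: CamachoLinsNeto1985, Ch. VII §2] -/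
structure StepFacts (s : ℝ) (q : ZMod (D.nprong P.v0)) : Prop where
  alpha : alphaSet hbi ι (P.pb (P.Pv.nb q s)) = {P.v0}
  btail : ∃ Eb : P.Pv.BwdTail hbi (P.pb (P.Pv.nb q s)), Eb.j = P.Pv.nb q s
  arrival : P.IsArrival (P.arr (P.Pv.nb q s))
  inner : P.InnerSide s (P.arr (P.Pv.nb q s))
  ftail : ∃ E : P.Pv.FwdTail hbi (P.pb (P.Pv.nb q s)), E.j = P.arr (P.Pv.nb q s)
  mem : ∀ r : F.Leaf (P.pb (P.Pv.nb q s)), ι (Leaf.pt r) ∈ discLeaf F ι x₀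
  omega : omegaSet hbi ι (P.pb (P.Pv.nb q s)) = {P.v0}
  cases : P.pb (P.Pv.nb q s) ∈ F.leaf (P.Z.sx 0) ∧ P.arr (P.Pv.nb q s) = P.jin0 ∨ ι '' F.leaf (P.pb (P.Pv.nb q s)) ⊆ P.U

include ho hK₀ hΩ hgen hterm hcterm in
/-- **The step facts hold at an arrival prong with an inner side.**
[cite: CamachoLinsNeto1985, Ch. VII §2] -/
theorem stepFacts [NormedSpace ℝ B] [LocallyConnectedSpace B] (hm : P.Z.m = 1) {s : ℝ} (hs : s = 1 ∨ s = -1) {q : ZMod (D.nprong P.v0)}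
    (hq : P.IsArrival q) (hqs : P.InnerSide s q) (hs0 : P.InnerSide s P.jin0) : P.StepFacts s q := by
  set Pv := P.Pv with hPv
  set p := Pv.nb q s with hp
  have hs0' : s ≠ 0 := by rcases hs with rfl | rfl <;> norm_num
  have hss : 0 < s * s := by rcases hs with rfl | rfl <;> norm_num
  obtain ⟨E, hE⟩ := hq.tail
  have hvω : P.v0 ∈ omegaSet hbi ι (P.pb q) := by rw [hq.omega]; exact mem_singleton _
  -- across the axis: the neighbour carries a backward tail of the leaf of `pb p`
  have hy : ∀ b ∈ Ioc 0 Pv.ρ, Pv.horiz hι (Pv.nb E.j s) 0 b ∈ F.leaf (P.pb p) := by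
    intro b hb; rw [hE]; exact P.horiz_mem_leaf_pb p hb
  obtain ⟨hvα, Eb, hEb, -⟩ := Pv.alphaSet_and_bwdTail_nb_of_fwdTail hbi hι E hvω hs0' hy
  rw [hE] at hEb
  -- the leaf of `pb p` is in the closure of the inside: follow the inner half-sector to the prong
  obtain ⟨δ, hδ, hδU⟩ := hqs.ev
  have hr : ∀ {b h : ℝ}, b ∈ Icc 0 Pv.ρ → h ∈ Icc (-Pv.ρ) Pv.ρ → ((b, h) : ℝ × ℝ) ∈ Pv.rect := fun hb hh ↦ ⟨hb, hh⟩
  have hinU : ∀ h, 0 < s * h → |h| < δ → |h| < Pv.ρ → ∀ b ∈ Icc 0 Pv.ρ, ι (Pv.horiz hι p h b) ∈ P.U := by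
    intro h hsh hhδ hhρ b hb
    have hh0 : h ≠ 0 := by rintro rfl; simp at hsh
    have hhI : h ∈ Icc (-Pv.ρ) Pv.ρ := ⟨(abs_lt.1 hhρ).1.le, (abs_lt.1 hhρ).2.le⟩
    set x := Pv.horiz hι q h Pv.ρ with hx
    have hιx : ι x = Pv.pt q (Pv.ρ, h) := Pv.ι_horiz hι (hr ⟨Pv.ρ_pos.le, le_rfl⟩ hhI) (fun h0 ↦ Pv.ρ_pos.ne' (congrArg Prod.fst h0))
    have hxS : ι x ∈ Pv.S q := by rw [hιx]; exact Pv.pt_mem (hr ⟨Pv.ρ_pos.le, le_rfl⟩ hhI)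
    have hHx : Pv.H (ι x) = h := by rw [hιx, Pv.H_pt (hr ⟨Pv.ρ_pos.le, le_rfl⟩ hhI)]
    have hmem := Pv.horiz_nb_mem_leaf hι hxS (by rw [hHx]; exact hh0) hb
    rw [hHx, Pv.nb_eq_nb_of_mul_pos (show 0 < h * s by nlinarith [hsh])] at hmem
    exact P.image_leaf_subset_U (hδU _ P.ρ_mem h hsh hhδ) ⟨_, hmem, rfl⟩
  have hcl : ι (P.pb p) ∈ closure P.U := by
    -- heights `h n = s c / (n + 1)`, `c` small
    set c : ℝ := min δ Pv.ρ / 2 with hc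
    have hcpos : 0 < c := by have := lt_min hδ Pv.ρ_pos; rw [hc]; linarith
    have hcδ : c < δ := by have := min_le_left δ Pv.ρ; rw [hc]; linarith
    have hcρ : c < Pv.ρ := by have := min_le_right δ Pv.ρ; rw [hc]; linarith [Pv.ρ_pos]
    set hs' : ℕ → ℝ := fun n ↦ s * (c * (1 / ((n : ℝ) + 1))) with hhs'
    have habs : ∀ n, |hs' n| = c * (1 / ((n : ℝ) + 1)) := fun n ↦ by
      have : 0 ≤ c * (1 / ((n : ℝ) + 1)) := by positivity
      show |s * (c * (1 / ((n : ℝ) + 1)))| = _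
      rw [abs_mul, (show |s| = 1 by rcases hs with rfl | rfl <;> norm_num), one_mul, abs_of_nonneg this]
    have hle : ∀ n : ℕ, c * (1 / ((n : ℝ) + 1)) ≤ c := fun n ↦ by
      have : 1 / ((n : ℝ) + 1) ≤ 1 := (div_le_one (by positivity)).2 (by linarith [n.cast_nonneg (α := ℝ)])
      nlinarith
    have hpos : ∀ n, 0 < s * hs' n := fun n ↦ by
      have : 0 < c * (1 / ((n : ℝ) + 1)) := by positivity
      show 0 < s * (s * (c * (1 / ((n : ℝ) + 1)))); rw [← mul_assoc]; nlinarith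
    have htend : Tendsto hs' atTop (𝓝 0) := by
      have h1 : Tendsto (fun n : ℕ ↦ s * (c * (1 / ((n : ℝ) + 1)))) atTop (𝓝 (s * (c * 0))) :=
        tendsto_const_nhds.mul (tendsto_const_nhds.mul tendsto_one_div_add_atTop_nhds_zero_nat)
      rwa [mul_zero, mul_zero] at h1
    have hcont : ContinuousAt (fun h ↦ Pv.horiz hι p h Pv.ρ) 0 :=
      (Pv.continuousOn_horiz_vert hι p P.ρ_mem).continuousAt (Icc_mem_nhds (by linarith [Pv.ρ_pos]) Pv.ρ_pos)
    have hlim : Tendsto (fun n ↦ ι (Pv.horiz hι p (hs' n) Pv.ρ)) atTop (𝓝 (ι (P.pb p))) :=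
      ((hι.continuous.continuousAt.comp hcont).tendsto).comp htend
    refine mem_closure_of_tendsto hlim (Eventually.of_forall fun n ↦ ?_)
    exact hinU (hs' n) (hpos n) (by rw [habs]; exact (hle n).trans_lt hcδ) (by rw [habs]; exact (hle n).trans_lt hcρ)
      Pv.ρ ⟨Pv.ρ_pos.le, le_rfl⟩
  rw [P.closure_U] at hcl
  -- the two cases
  have hcases : P.pb p ∈ F.leaf (P.Z.sx 0) ∨ ι '' F.leaf (P.pb p) ⊆ P.U := by
    rcases hcl with h | h
    · exact Or.inr (P.image_leaf_subset_U h)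
    · exact Or.inl (P.mem_leaf_of_mem_range hm h)
  -- the leaf of `pb p`: in the disc, with `ω = α = {v0}`
  have hfacts : (∀ r : F.Leaf (P.pb p), ι (Leaf.pt r) ∈ discLeaf F ι x₀) ∧ omegaSet hbi ι (P.pb p) = {P.v0} ∧
      alphaSet hbi ι (P.pb p) = {P.v0} := by
    rcases hcases with hS | hUU
    · have hleaf : F.leaf (P.pb p) = F.leaf (P.Z.sx 0) := leaf_eq_of_mem hS
      refine ⟨fun r ↦ P.Z.hmem 0 (Leaf.mk (Leaf.pt r) (by rw [← hleaf]; exact r.2)), ?_, ?_⟩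
      · rw [omegaSet_eq_of_mem_leaf (hbi := hbi) hS]; exact P.omega0
      · rw [alphaSet_eq_of_mem_leaf (hbi := hbi) hS]; exact P.alpha0 hm
    · obtain ⟨⟨w, hwP, hw, -⟩, ⟨w', -, hw', -⟩⟩ := P.limitSets_of_inner ho hK₀ hΩ hterm hcterm hUU
      have hw'v : w' = P.v0 := by rw [hw'] at hvα; exact (mem_singleton_iff.1 hvα).symm
      rw [hw'v] at hw'
      have hwv : w = P.v0 := hgen _ (P.mem_disc_of_U hK₀ hUU) _ hwP _ P.v0_mem hw hw'
      rw [hwv] at hw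
      exact ⟨P.mem_disc_of_U hK₀ hUU, hw, hw'⟩
  obtain ⟨hmemp, hωp, hαp⟩ := hfacts
  -- the arrival prong of that leaf
  obtain ⟨E'⟩ := Pv.nonempty_fwdTail hι (hbi := hbi) hC₀ hmemp hωp
  have harr : P.arr p = E'.j := P.arr_eq hmemp hωp (F.mem_leaf_self _) E'
  -- its prong base point is on the same leaf
  have hq'mem : P.pb (P.arr p) ∈ F.leaf (P.pb p) := by rw [harr]; exact Pv.horiz_mem_leaf_of_fwdTail hbi hι E' P.ρ_mem
  have hleaf' : F.leaf (P.pb (P.arr p)) = F.leaf (P.pb p) := leaf_eq_of_mem hq'mem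
  have harrival : P.IsArrival (P.arr p) := by
    refine ⟨fun r ↦ hmemp (Leaf.mk (Leaf.pt r) (by rw [← hleaf']; exact r.2)), ?_, ?_⟩
    · rw [omegaSet_eq_of_mem_leaf (hbi := hbi) hq'mem]; exact hωp
    · obtain ⟨E''⟩ := Pv.nonempty_fwdTail hι (hbi := hbi) hC₀ (x := P.pb (P.arr p))
        (fun r ↦ hmemp (Leaf.mk (Leaf.pt r) (by rw [← hleaf']; exact r.2)))
        (by rw [omegaSet_eq_of_mem_leaf (hbi := hbi) hq'mem]; exact hωp)
      exact ⟨E'', (ProngStar.FwdTail.j_eq_of_mem_leaf Pv hq'mem E' E'').symm.trans harr.symm⟩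
  -- the inner side at the new arrival prong
  have hcases' : P.pb p ∈ F.leaf (P.Z.sx 0) ∧ P.arr p = P.jin0 ∨ ι '' F.leaf (P.pb p) ⊆ P.U := by
    rcases hcases with hS | hUU
    · refine Or.inl ⟨hS, ?_⟩
      rw [P.arr_eq hmemp hωp (mem_leaf_comm.1 hS) P.jcZ.Ef]; rfl
    · exact Or.inr hUU
  have hinner : P.InnerSide s (P.arr p) := by
    rcases hcases' with ⟨-, hj⟩ | hUU
    · rw [hj]; exact hs0
    · -- the prong points of `arr p` are inside; openness and continuity in the height
      have hin0 : ι (P.pb (P.arr p)) ∈ P.U := hUU ⟨_, hq'mem, rfl⟩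
      have hcont : ContinuousAt (fun h ↦ Pv.horiz hι (P.arr p) h Pv.ρ) 0 :=
        (Pv.continuousOn_horiz_vert hι (P.arr p) P.ρ_mem).continuousAt (Icc_mem_nhds (by linarith [Pv.ρ_pos]) Pv.ρ_pos)
      have hev : ∀ᶠ h in 𝓝 (0 : ℝ), ι (Pv.horiz hι (P.arr p) h Pv.ρ) ∈ P.U :=
        (hι.continuous.continuousAt.comp hcont) ((P.Z.isJordanLoop_loop hι hC₀).isOpen_inside.mem_nhds hin0)
      obtain ⟨δ', hδ', hball⟩ := Metric.eventually_nhds_iff.1 hev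
      exact P.innerSide_of_ρ (lt_min hδ' Pv.ρ_pos) (min_le_right _ _) fun h _ hh ↦
        hball (by rw [dist_zero_right, Real.norm_eq_abs]; exact hh.trans_le (min_le_left _ _))
  exact ⟨hαp, ⟨Eb, hEb⟩, harrival, hinner, ⟨E', harr.symm⟩, hmemp, hωp, hcases'⟩

include ho hK₀ hΩ hgen hterm hcterm in
/-- **Along the orbit of the arrival prong of `S₀`, every prong is an arrival prong with inner
side `s`.** [folklore] -/
theorem orbit_invariant [NormedSpace ℝ B] [LocallyConnectedSpace B] (hm : P.Z.m = 1) {s : ℝ} (hs : s = 1 ∨ s = -1) (hs0 : P.InnerSide s P.jin0)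
    (k : ℕ) : P.IsArrival (P.orbit s P.jin0 k) ∧ P.InnerSide s (P.orbit s P.jin0 k) := by
  induction k with
  | zero => exact ⟨P.isArrival_jin0, hs0⟩
  | succ k ih =>
    rw [orbit_succ]
    have h := P.stepFacts ho hK₀ hΩ hgen hterm hcterm hm hs ih.1 ih.2 hs0
    exact ⟨h.arrival, h.inner⟩

include ho hK₀ hΩ hgen hterm hcterm in
/-- **The successor is injective on arrival prongs with inner side `s`**: two such prongs with
the same successor depart, across the axis, on backward tails of one leaf. [folklore] -/
theorem nextProng_injOn [NormedSpace ℝ B] [LocallyConnectedSpace B] (hm : P.Z.m = 1) {s : ℝ} (hs : s = 1 ∨ s = -1) (hs0 : P.InnerSide s P.jin0)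
    {q q' : ZMod (D.nprong P.v0)} (hq : P.IsArrival q) (hqs : P.InnerSide s q) (hq' : P.IsArrival q') (hqs' : P.InnerSide s q')
    (h : P.nextProng s q = P.nextProng s q') : q = q' := by
  have f := P.stepFacts ho hK₀ hΩ hgen hterm hcterm hm hs hq hqs hs0
  have f' := P.stepFacts ho hK₀ hΩ hgen hterm hcterm hm hs hq' hqs' hs0
  obtain ⟨E, hE⟩ := f.ftail
  obtain ⟨E', hE'⟩ := f'.ftail
  unfold nextProng at h
  -- the prong base point of the common arrival prong is on both leaves
  have h1 : P.pb (P.arr (P.Pv.nb q s)) ∈ F.leaf (P.pb (P.Pv.nb q s)) := by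
    rw [← hE]; exact P.Pv.horiz_mem_leaf_of_fwdTail hbi hι E P.ρ_mem
  have h2 : P.pb (P.arr (P.Pv.nb q' s)) ∈ F.leaf (P.pb (P.Pv.nb q' s)) := by
    rw [← hE']; exact P.Pv.horiz_mem_leaf_of_fwdTail hbi hι E' P.ρ_mem
  rw [h] at h1
  have h12 : P.pb (P.Pv.nb q' s) ∈ F.leaf (P.pb (P.Pv.nb q s)) := by
    rw [← leaf_eq_of_mem h1, leaf_eq_of_mem h2]; exact F.mem_leaf_self _
  obtain ⟨Eb, hEb⟩ := f.btail
  obtain ⟨Eb', hEb'⟩ := f'.btail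
  have hj : Eb.j = Eb'.j := ProngStar.BwdTail.j_eq_of_mem_leaf P.Pv h12 Eb Eb'
  rw [hEb, hEb'] at hj
  exact P.Pv.nb_injective hs hj

include ho hK₀ hΩ hgen hterm hcterm in
/-- **The prong orbit of the arrival prong of `S₀` is periodic.** [folklore] -/
theorem exists_period [NormedSpace ℝ B] [LocallyConnectedSpace B] (hm : P.Z.m = 1) {s : ℝ} (hs : s = 1 ∨ s = -1) (hs0 : P.InnerSide s P.jin0) :
    ∃ m' : ℕ, 0 < m' ∧ P.orbit s P.jin0 m' = P.jin0 ∧ ∀ k, 0 < k → k < m' → P.orbit s P.jin0 k ≠ P.jin0 := by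
  -- two equal terms, by finiteness
  obtain ⟨i, j, hij, heq⟩ := Finite.exists_ne_map_eq_of_infinite (P.orbit s P.jin0)
  -- cancel the common steps
  have hcancel : ∀ a b, P.orbit s P.jin0 a = P.orbit s P.jin0 b → P.orbit s P.jin0 0 = P.orbit s P.jin0 (b - a) ∨ b < a := by
    intro a
    induction a with
    | zero => intro b h; exact Or.inl (by simpa using h)
    | succ a ih =>
      intro b h
      cases b with
      | zero => exact Or.inr (Nat.succ_pos a)
      | succ b =>
        rw [orbit_succ, orbit_succ] at h
        have ha := P.orbit_invariant ho hK₀ hΩ hgen hterm hcterm hm hs hs0 a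
        have hb := P.orbit_invariant ho hK₀ hΩ hgen hterm hcterm hm hs hs0 b
        have h' := P.nextProng_injOn ho hK₀ hΩ hgen hterm hcterm hm hs hs0 ha.1 ha.2 hb.1 hb.2 h
        rcases ih b h' with h'' | h''
        · exact Or.inl (by rwa [Nat.succ_sub_succ])
        · exact Or.inr (Nat.succ_lt_succ h'')
  have hper : ∃ d, 0 < d ∧ P.orbit s P.jin0 d = P.jin0 := by
    rcases lt_or_gt_of_ne hij with hlt | hlt
    · rcases hcancel i j heq with h | h
      · exact ⟨j - i, Nat.sub_pos_of_lt hlt, by rw [← h]; rfl⟩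
      · exact absurd hlt (not_lt.2 h.le)
    · rcases hcancel j i heq.symm with h | h
      · exact ⟨i - j, Nat.sub_pos_of_lt hlt, by rw [← h]; rfl⟩
      · exact absurd hlt (not_lt.2 h.le)
  classical
  refine ⟨Nat.find hper, (Nat.find_spec hper).1, (Nat.find_spec hper).2, fun k hk hkm h ↦ ?_⟩
  exact Nat.find_min hper hkm ⟨hk, h⟩

/-! ## Stage B: the facial cycle data -/

section Facial

variable (s : ℝ) (m' : ℕ)

/-- **The punctures of the facial cycle**: all equal to the saddle. [folklore] -/
def fvtx (_ : Fin m') : ℂ := P.v0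

/-- **The separatrix base points of the facial cycle**: `S₀` first, then the prong base points
of the orbit. [folklore] -/
def fsx (k : Fin m') : X := if (k : ℕ) = 0 then P.Z.sx 0 else P.pb (P.orbit s P.jin0 k)

/-- The leaves of the facial cycle are open. [folklore] -/
instance fsx_nc : ∀ k : Fin m', NoncompactSpace (F.Leaf (P.fsx s m' k)) := fun k ↦ by
  by_cases h : (k : ℕ) = 0
  · rw [fsx, if_pos h]; exact P.Z.instNoncompactSpace 0
  · rw [fsx, if_neg h]; exact P.instNoncompactPb _

/-- The punctures of the facial cycle are punctures. [folklore] -/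
theorem fhv : ∀ k : Fin m', P.fvtx m' k ∈ D.P := fun _ ↦ P.v0_mem

variable {s m'}

/-- The value of a successor index. [folklore] -/
theorem val_succ [NeZero m'] (k : Fin m') : ((k + 1 : Fin m') : ℕ) = ((k : ℕ) + 1) % m' := by
  rw [Fin.val_add, Fin.val_one', Nat.add_mod_mod]

/-- The first base point is that of `S₀`. [folklore] -/
theorem fsx_of_eq_zero {k : Fin m'} (hk : (k : ℕ) = 0) : P.fsx s m' k = P.Z.sx 0 := by
  unfold fsx; rw [if_pos hk]

/-- The later base points are the prong base points of the orbit. [folklore] -/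
theorem fsx_of_ne_zero {k : Fin m'} (hk : (k : ℕ) ≠ 0) : P.fsx s m' k = P.pb (P.orbit s P.jin0 k) := by
  unfold fsx; rw [if_neg hk]

variable [NormedSpace ℝ B] [LocallyConnectedSpace B] (hm : P.Z.m = 1) (hs : s = 1 ∨ s = -1) (hs0 : P.InnerSide s P.jin0)
  [NeZero m'] (hper : P.orbit s P.jin0 m' = P.jin0)

include ho hK₀ hΩ hgen hterm hcterm hm hs hs0 in
/-- The prong base point of the next orbit prong is on the leaf departing across the axis.
[folklore] -/
theorem pb_orbit_succ_mem (k : ℕ) :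
    P.pb (P.orbit s P.jin0 (k + 1)) ∈ F.leaf (P.pb (P.Pv.nb (P.orbit s P.jin0 k) s)) := by
  have f := P.stepFacts ho hK₀ hΩ hgen hterm hcterm hm hs (P.orbit_invariant ho hK₀ hΩ hgen hterm hcterm hm hs hs0 k).1
    (P.orbit_invariant ho hK₀ hΩ hgen hterm hcterm hm hs hs0 k).2 hs0
  obtain ⟨E, hE⟩ := f.ftail
  have h := P.Pv.horiz_mem_leaf_of_fwdTail hbi hι E P.ρ_mem
  rw [hE] at h
  rw [orbit_succ]
  exact h

include ho hK₀ hΩ hgen hterm hcterm hm hs hs0 hper in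
omit [NeZero m'] in
/-- **Closing**: the leaf departing across the axis from the last orbit prong is `S₀`. [folklore] -/
theorem sx0_mem_of_wrap {k : ℕ} (hk : k + 1 = m') : P.Z.sx 0 ∈ F.leaf (P.pb (P.Pv.nb (P.orbit s P.jin0 k) s)) := by
  have f := P.stepFacts ho hK₀ hΩ hgen hterm hcterm hm hs (P.orbit_invariant ho hK₀ hΩ hgen hterm hcterm hm hs hs0 k).1
    (P.orbit_invariant ho hK₀ hΩ hgen hterm hcterm hm hs hs0 k).2 hs0
  have harr : P.arr (P.Pv.nb (P.orbit s P.jin0 k) s) = P.jin0 := by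
    have h1 : P.orbit s P.jin0 (k + 1) = P.jin0 := by rw [hk]; exact hper
    rw [orbit_succ] at h1
    exact h1
  rcases f.cases with ⟨hS, -⟩ | hUU
  · exact mem_leaf_comm.1 hS
  · -- inner is impossible: the arrival prong `jin0` is on the trace
    exfalso
    obtain ⟨E, hE⟩ := f.ftail
    have h1 := P.Pv.horiz_mem_leaf_of_fwdTail hbi hι E P.ρ_mem
    rw [hE, harr] at h1
    exact P.not_mem_U_of_mem_range (P.mem_range_of_mem_leaf (P.horiz_jin0_mem P.ρ_mem)) (hUU ⟨_, h1, rfl⟩)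

include ho hK₀ hΩ hgen hterm hcterm hm hs hs0 hper in
/-- **The next base point is on the leaf departing across the axis.** [folklore] -/
theorem fsx_succ_mem (k : Fin m') : P.fsx s m' (k + 1) ∈ F.leaf (P.pb (P.Pv.nb (P.orbit s P.jin0 k) s)) := by
  have hval := val_succ k (m' := m')
  by_cases hlt : (k : ℕ) + 1 < m'
  · rw [Nat.mod_eq_of_lt hlt] at hval
    rw [P.fsx_of_ne_zero (by rw [hval]; omega), hval]
    exact P.pb_orbit_succ_mem ho hK₀ hΩ hgen hterm hcterm hm hs hs0 k
  · have heq : (k : ℕ) + 1 = m' := by have := k.2; omega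
    rw [heq, Nat.mod_self] at hval
    rw [P.fsx_of_eq_zero hval]
    exact P.sx0_mem_of_wrap ho hK₀ hΩ hgen hterm hcterm hm hs hs0 hper heq

include ho hK₀ hΩ hgen hterm hcterm hm hs hs0 in
omit [NeZero m'] in
/-- **The leaves of the facial cycle lie in the ambient disc.** [folklore] -/
theorem fhmem (k : Fin m') (q : F.Leaf (P.fsx s m' k)) : ι (Leaf.pt q) ∈ discLeaf F ι x₀ := by
  by_cases hk : (k : ℕ) = 0
  · have h := P.fsx_of_eq_zero (s := s) hk
    exact P.Z.hmem 0 (Leaf.mk (Leaf.pt q) (by rw [← h]; exact q.2))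
  · have h := P.fsx_of_ne_zero (s := s) hk
    exact (P.orbit_invariant ho hK₀ hΩ hgen hterm hcterm hm hs hs0 k).1.mem (Leaf.mk (Leaf.pt q) (by rw [← h]; exact q.2))

include ho hK₀ hΩ hgen hterm hcterm hm hs hs0 in
omit [NeZero m'] in
/-- **The leaves of the facial cycle arrive at the saddle.** [folklore] -/
theorem fhω (k : Fin m') : omegaSet hbi ι (P.fsx s m' k) = {P.fvtx m' k} := by
  show omegaSet hbi ι (P.fsx s m' k) = {P.v0}
  by_cases hk : (k : ℕ) = 0
  · have h := P.fsx_of_eq_zero (s := s) (m' := m') hk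
    rw [omegaSet_eq_of_mem_leaf (hbi := hbi) (show P.fsx s m' k ∈ F.leaf (P.Z.sx 0) by rw [h]; exact F.mem_leaf_self _)]
    exact P.omega0
  · have h := P.fsx_of_ne_zero (s := s) (m' := m') hk
    rw [omegaSet_eq_of_mem_leaf (hbi := hbi) (show P.fsx s m' k ∈ F.leaf (P.pb (P.orbit s P.jin0 k)) by rw [h]; exact F.mem_leaf_self _)]
    exact (P.orbit_invariant ho hK₀ hΩ hgen hterm hcterm hm hs hs0 k).1.omega

include ho hK₀ hΩ hgen hterm hcterm hm hs hs0 hper in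
/-- **The leaves of the facial cycle depart from the saddle.** [folklore] -/
theorem fhα (k : Fin m') : alphaSet hbi ι (P.fsx s m' (k + 1)) = {P.fvtx m' k} := by
  show alphaSet hbi ι (P.fsx s m' (k + 1)) = {P.v0}
  have f := P.stepFacts ho hK₀ hΩ hgen hterm hcterm hm hs (P.orbit_invariant ho hK₀ hΩ hgen hterm hcterm hm hs hs0 k).1
    (P.orbit_invariant ho hK₀ hΩ hgen hterm hcterm hm hs hs0 k).2 hs0
  rw [alphaSet_eq_of_mem_leaf (hbi := hbi) (P.fsx_succ_mem ho hK₀ hΩ hgen hterm hcterm hm hs hs0 hper k)]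
  exact f.alpha

include ho hK₀ hΩ hgen hterm hcterm hm hs hs0 in
omit [NeZero m'] in
/-- A forward tail of the leaf `k` of the facial cycle on the orbit prong `k`. [folklore] -/
theorem ftail_fsx (k : Fin m') : ∃ E : P.Pv.FwdTail hbi (P.fsx s m' k), E.j = P.orbit s P.jin0 k := by
  obtain ⟨E₀⟩ := P.Pv.nonempty_fwdTail hι (hbi := hbi) hC₀ (P.fhmem ho hK₀ hΩ hgen hterm hcterm hm hs hs0 k)
    (P.fhω ho hK₀ hΩ hgen hterm hcterm hm hs hs0 k)
  refine ⟨E₀, ?_⟩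
  by_cases hk : (k : ℕ) = 0
  · have h := P.fsx_of_eq_zero (s := s) (m' := m') hk
    have hmem : P.Z.sx 0 ∈ F.leaf (P.fsx s m' k) := by rw [h]; exact F.mem_leaf_self _
    rw [ProngStar.FwdTail.j_eq_of_mem_leaf P.Pv hmem E₀ P.jcZ.Ef, hk]
    rfl
  · have h := P.fsx_of_ne_zero (s := s) (m' := m') hk
    have hmem : P.pb (P.orbit s P.jin0 k) ∈ F.leaf (P.fsx s m' k) := by rw [h]; exact F.mem_leaf_self _
    obtain ⟨E, hE⟩ := (P.orbit_invariant ho hK₀ hΩ hgen hterm hcterm hm hs hs0 k).1.tail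
    rw [ProngStar.FwdTail.j_eq_of_mem_leaf P.Pv hmem E₀ E, hE]

include ho hK₀ hΩ hgen hterm hcterm hm hs hs0 hper in
/-- A backward tail of the leaf `k + 1` of the facial cycle on the neighbour of the orbit prong
`k`. [folklore] -/
theorem btail_fsx (k : Fin m') : ∃ Eb : P.Pv.BwdTail hbi (P.fsx s m' (k + 1)), Eb.j = P.Pv.nb (P.orbit s P.jin0 k) s := by
  have f := P.stepFacts ho hK₀ hΩ hgen hterm hcterm hm hs (P.orbit_invariant ho hK₀ hΩ hgen hterm hcterm hm hs hs0 k).1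
    (P.orbit_invariant ho hK₀ hΩ hgen hterm hcterm hm hs hs0 k).2 hs0
  obtain ⟨Eb0, hEb0⟩ := f.btail
  have hmem := P.fsx_succ_mem ho hK₀ hΩ hgen hterm hcterm hm hs hs0 hper k
  obtain ⟨Eb⟩ := P.Pv.nonempty_bwdTail hι (hbi := hbi) hC₀ (P.fhmem ho hK₀ hΩ hgen hterm hcterm hm hs hs0 (k + 1))
    (P.fhα ho hK₀ hΩ hgen hterm hcterm hm hs hs0 hper k)
  exact ⟨Eb, (ProngStar.BwdTail.j_eq_of_mem_leaf P.Pv hmem Eb0 Eb).symm.trans hEb0⟩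

include hper in
/-- **The turn rule of the facial walk**: at every junction the planar leaves turn to the side
`s`. [folklore] -/
theorem fturn (k : ℕ) :
    (D.walkJ hι hC₀ (P.fhv m') (P.fhmem ho hK₀ hΩ hgen hterm hcterm hm hs hs0) (P.fhω ho hK₀ hΩ hgen hterm hcterm hm hs hs0)
        (P.fhα ho hK₀ hΩ hgen hterm hcterm hm hs hs0 hper) k).jout =
      (D.walkJ hι hC₀ (P.fhv m') (P.fhmem ho hK₀ hΩ hgen hterm hcterm hm hs hs0) (P.fhω ho hK₀ hΩ hgen hterm hcterm hm hs hs0)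
        (P.fhα ho hK₀ hΩ hgen hterm hcterm hm hs hs0 hper) k).turn s := by
  set i := idx m' k with hi
  set J' := D.jc hι hC₀ (P.fhv m') (P.fhmem ho hK₀ hΩ hgen hterm hcterm hm hs hs0) (P.fhω ho hK₀ hΩ hgen hterm hcterm hm hs hs0)
    (P.fhα ho hK₀ hΩ hgen hterm hcterm hm hs hs0 hper) i with hJ'
  obtain ⟨E, hE⟩ := P.ftail_fsx ho hK₀ hΩ hgen hterm hcterm hm hs hs0 i
  obtain ⟨Eb, hEb⟩ := P.btail_fsx ho hK₀ hΩ hgen hterm hcterm hm hs hs0 hper i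
  have h1 : J'.Ef.j = P.orbit s P.jin0 i := (ProngStar.FwdTail.j_eq J'.Ef E).trans hE
  have h2 : J'.Eb.j = P.Pv.nb (P.orbit s P.jin0 i) s := (ProngStar.BwdTail.j_eq J'.Eb Eb).trans hEb
  show J'.Eb.j = (if 0 ≤ P.Pv.sg J'.Ef.j * s then J'.Ef.j + 1 else J'.Ef.j - 1)
  rw [h2, h1]; rfl

end Facial
end PolyPattern

end StarData

end Literature.Topology.PlanarFoliations
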